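import Literature.MathematicalPhysics.QuantumFieldTheory.Balaban1983to89.B9SectBGpLettersY
import Literature.MathematicalPhysics.QuantumFieldTheory.Balaban1983to89.B9Thm39CinvSandwichQ

/-!
# Balaban [B9], (3.19)–(3.21) pp. 393–394 + (3.48) p. 398 + (3.57) p. 401 — THE LETTERS OF THE C⁻¹ = (Q′G′²Q′*)⁻¹ CLAUSE OVER THE CODED
# CARRIER OF NODE 00 (def-Y): `QcC`, `QcsC` (Q′(U), Q′*(U) in real coordinates between the site carrier and the BLOCK CARRIER `BlkY × ι`),
# `CopC` (C⁻¹(V) = η⁻⁴·(Q′G′²Q′*)⁻¹(dec V) in real coordinates), the (3.57) variations `FcC`, `FcsC`, and their ALGEBRAIC laws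
# (`XC_eq`, ★ `copC_eq`, ★ `XC_mul_CopC`, `qcC_prod`), the (3.19) majorants (`hQc` ∕ `hQcs`) and kernel-reading tools — the data and the fields
# `cop_eq` ∕ `reg_cinv` ∕ `q_mul` ∕ `hQc` ∕ `hQcs` of `B9SectBKerFrameV3.CinvFrame₃` at NODE 00's letters (companion of `B9SectBGpLettersY`: `ΔpC`, `GopC`, `gopC_eq`)

WHAT.  For a k-level index `i`, site transporters `par` and a real basis `b` of `𝔸` (`conj b` ∕ `conjHom b` = real coordinates, [4] (2.51)):
* `QcC i par b V := conjHom b (Q′(dec V)|_ℝ)`, `QcsC i par b V := conjHom b (Q′*(dec V)|_ℝ)` (`Q′ = Node00.QpY i par`, `Q′* = Node00.QpsY i par`, (3.19)∕(3.21));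
* `CopC i par b V := conj b (η⁻⁴·(Q′G′²Q′*)⁻¹(dec V)|_ℝ)` (`Node00.XinvY i par (GpY i par)`; the η⁻⁴ matches `GopC = conj b (η²G′)`: `Q′(η²G′)²Q′* = η⁴·Q′G′²Q′*`);
* `FcC ∕ FcsC` : at a (base U, multiplier a) pair the differences `QcC (prod U a) − QcC (base U)` ∕ `QcsC (prod U a) − QcsC (base U)` ((3.57):
  Q′(U′U) = Q′(U) + F′₂), `0` at every other pair;
* `XC_eq` : `QcC V ∘ (GopC V)² ∘ QcsC V = conj b (η⁴·(Q′G′²Q′*)(dec V)|_ℝ)`; ★ `copC_eq` : C⁻¹(V) IS the two-sided inverse of that operator whenever one exists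
  (field `cop_eq`); ★ `XC_mul_CopC` : if `(Q′G′²Q′*)(dec V)` is a unit (Thm 3.2 ∕ 3.11's regime — at the record `B9Thm311PosAtRecordV4.isUnit_XY_parSymY`) the two
  inverse identities hold (field `reg_cinv`); `qcC_prod` ∕ `qcsC_prod` : the (3.57) splitting at a (base, multiplier) pair (field `q_mul`).
* §3 the (3.19) block-local two-space majorants of `QcC ∕ QcsC` at a base with contractive transporters (fields `hQc` ∕ `hQcs`) — pv's
  `B9Thm39CinvSandwichQ.hasMajorantHom_conjHom_QpY ∕ _QpsY` (the same letters, Thm 3.9's sandwich) put in the frame's shape `κ_Q·𝟙[a = a′]`, `κ_Q = M₂Σ_j‖b_j‖`;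
* §4 kernel-reading tools for the block sector: `entry_CopC` (the matrix entries of `CopC` through the basis deltas `δ_{s′} ⊗ b_{j′}`), `deltaY_eq_sum_repr`,
  `norm_apply_deltaY_le` ∕ `bddAbove_norm_apply_deltaY` ∕ `norm_apply_deltaY_basis_le` (a letter on an `𝔸`-valued delta is bounded over the unit ball, and a basis
  vector is below `‖b_j‖·sup`);
* §5 (v1.1) the block-compatible injective section `repY : BlkY × ι → SiteY × ι` (corner site; `blkC_repY`, `repY_injective`) — the binders `rep ∕ hrep ∕ hinj`
  of r06's block-carrier clauses and of `B9SectBGFrameV3.GFrame₃` at node00-def-Y's carriers.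
The (3.59) majorants of `FcC ∕ FcsC` and the (3.48) kernel read ∕ write through `CY = XinvY ∘ diag(cWtY)` are in the instance file `B9SectBKerFrameCodedY`.

HONEST FRAMING.  Definitions and ring algebra (`Ring.inverse`, conjugation by the coordinate equivalence); nothing of print asserted.  Fixed `k`; one finite-lattice
programme — not continuum ∕ OS ∕ mass gap ∕ Clay.
-/

namespace Literature.MathematicalPhysics.QuantumFieldTheory.Balaban1983to89.B9SectBKerLettersY

open Literature.MathematicalPhysics.QuantumFieldTheory.Balaban1983to89.B9Eq39Adjoint (R R_zero fluct)
open Literature.MathematicalPhysics.QuantumFieldTheory.Balaban1983to89.B6RandomWalkHom (HasMajorantHom hasMajorantHom_mono)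
open Literature.MathematicalPhysics.QuantumFieldTheory.Balaban1983to89.B9Thm34Ext (toB6)
open Literature.MathematicalPhysics.QuantumFieldTheory.Balaban1983to89.B6Geom246MultiLevelBox (blkOf)
open Literature.MathematicalPhysics.QuantumFieldTheory.Balaban1983to89.B6Ineq2142KLevelV1 (β)
open Literature.MathematicalPhysics.QuantumFieldTheory.Balaban1983to89.B9GeoNormsKLevelV1 (geo9K)
open Literature.MathematicalPhysics.QuantumFieldTheory.Balaban1983to89.B9Thm311ReadingAtLetters (wB wB_pos)
open Literature.MathematicalPhysics.QuantumFieldTheory.Balaban1983to89.B9Eq360Vprime (norm_R_le_of_unit)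
open Literature.MathematicalPhysics.QuantumFieldTheory.Balaban1983to89.B9Eq352DivFormLetters (conj coordEquiv coordEquiv_symm_apply norm_coordSymm_apply_le)
open Literature.MathematicalPhysics.QuantumFieldTheory.Balaban1983to89.B9Eq376POneLetters (conjHom conjHom_apply conjHom_comp conjHom_eq_conj conjHom_sub
  conjHom_add)
open Literature.MathematicalPhysics.QuantumFieldTheory.Balaban1983to89.B6KLevelCensusIndexV1 (KIdx kGeo)
open Literature.MathematicalPhysics.QuantumFieldTheory.Balaban1983to89.B9SectBCodedCarrier (CCfg)
open Literature.MathematicalPhysics.QuantumFieldTheory.Balaban1983to89.B9Eq360DeltaPrimeAY (mulY AfldY blkY blkY_apply)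
open Literature.MathematicalPhysics.QuantumFieldTheory.Balaban1983to89.B9SectBGpLettersY (decY decY_base GopC conj_one blkC)
open Literature.MathematicalPhysics.QuantumFieldTheory.Balaban1983to89.Node00 (SiteY BlkY IBondY CfgY SiteParY GpY QpY QpsY XY XinvY qpK qpsK qpT
  blkCornerY trLiftY trLiftY_apply deltaY BallY)
open Literature.MathematicalPhysics.QuantumFieldTheory.Balaban1983to89.B9Thm34Inv (entry)

variable {d ℓ : ℕ} {hd : 1 ≤ d + 1} {hL : Odd (ℓ + 1) ∧ 1 < ℓ + 1} {b₀ b₁ : ℝ}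
variable {𝔸 : Type} [NormedRing 𝔸] [NormedAlgebra ℂ 𝔸] [CompleteSpace 𝔸]

/-! ## §1 The letters -/

section Letters

variable (i : KIdx d ℓ hd hL b₀ b₁) (par : SiteParY 𝔸 i) {ι : Type} [Fintype ι] (b : Module.Basis ι ℝ 𝔸)

/-- **the letter `Qc = Q′(V)`** (3.19)∕(3.21) in real coordinates, from the site carrier `SiteY × ι` to the block carrier `BlkY × ι`, at every coded configuration
(genuine at its decoding). [cite: Balaban1985BackgroundPropagators, (3.19) p.393, (3.21) p.394] -/
noncomputable def QcC (c : CCfg (CfgY 𝔸 i) (AfldY 𝔸 i)) : (SiteY i × ι → ℝ) →ₗ[ℝ] (BlkY i × ι → ℝ) :=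
  conjHom b ((QpY i par (decY i c)).restrictScalars ℝ)

/-- **the letter `Qcs = Q′*(V)`** (3.24) in real coordinates, from the block carrier to the site carrier. [cite: Balaban1985BackgroundPropagators, (3.24) p.394] -/
noncomputable def QcsC (c : CCfg (CfgY 𝔸 i) (AfldY 𝔸 i)) : (BlkY i × ι → ℝ) →ₗ[ℝ] (SiteY i × ι → ℝ) :=
  conjHom b ((QpsY i par (decY i c)).restrictScalars ℝ)

/-- **the letter `Cop = C⁻¹(V) = (Q′G′²Q′*)⁻¹(V)`** (3.21), print's units (`η⁻⁴`: G′ ↦ η²G′), in real coordinates on the block carrier, at every coded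
configuration: `conj b (η⁻⁴·XinvY(dec V))`, `XinvY = Ring.inverse (Q′G′²Q′*)` (the genuine inverse in Thm 3.2's regime, `0` elsewhere).
[cite: Balaban1985BackgroundPropagators, (3.21) p.394, (3.25) p.395, Thm 3.2 p.398] -/
noncomputable def CopC (c : CCfg (CfgY 𝔸 i) (AfldY 𝔸 i)) : Module.End ℝ (BlkY i × ι → ℝ) :=
  conj b (((kGeo i).eta ^ 4)⁻¹ • (XinvY i par (GpY i par) (decY i c)).restrictScalars ℝ)

/-- **the (3.57) variation letter `Fc = F′₂`**: `Q′(U′U) − Q′(U)` at a (base `U`, multiplier `a`) pair (`U′ = e^{iηa}`), `0` at every other pair.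
[cite: Balaban1985BackgroundPropagators, (3.57) p.401] -/
noncomputable def FcC : CCfg (CfgY 𝔸 i) (AfldY 𝔸 i) → CCfg (CfgY 𝔸 i) (AfldY 𝔸 i) → (SiteY i × ι → ℝ) →ₗ[ℝ] (BlkY i × ι → ℝ)
  | .base U, .mult a => QcC i par b (.prod U a) - QcC i par b (.base U)
  | _, _ => 0

/-- **the (3.57) variation letter `Fcs = F′₂*`**: `Q′*(U′U) − Q′*(U)` at a (base, multiplier) pair, `0` elsewhere. [cite: Balaban1985BackgroundPropagators, (3.57) p.401] -/
noncomputable def FcsC : CCfg (CfgY 𝔸 i) (AfldY 𝔸 i) → CCfg (CfgY 𝔸 i) (AfldY 𝔸 i) → (BlkY i × ι → ℝ) →ₗ[ℝ] (SiteY i × ι → ℝ)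
  | .base U, .mult a => QcsC i par b (.prod U a) - QcsC i par b (.base U)
  | _, _ => 0

end Letters

/-! ## §2 The algebraic laws: `XC_eq`, `copC_eq` (field `cop_eq`), `XC_mul_CopC` (field `reg_cinv`), the (3.57) splitting (field `q_mul`) -/

section Laws

variable (i : KIdx d ℓ hd hL b₀ b₁) (par : SiteParY 𝔸 i) {ι : Type} [Fintype ι] (b : Module.Basis ι ℝ 𝔸)

/-- the composite `Q′(V) ∘ (η²G′(V))² ∘ Q′*(V)` of the letters IS `conj b (η⁴·(Q′G′²Q′*)(dec V))`. [cite: Balaban1985BackgroundPropagators, (3.21) p.394, (3.25) p.395, bookkeeping] -/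
theorem XC_eq (c : CCfg (CfgY 𝔸 i) (AfldY 𝔸 i)) :
    QcC i par b c ∘ₗ (GopC i par b c * GopC i par b c) ∘ₗ QcsC i par b c =
      conj b (((kGeo i).eta ^ 4) • (XY i par (GpY i par) (decY i c)).restrictScalars ℝ) := by
  rw [QcC, QcsC, GopC, ← conjHom_eq_conj, ← conjHom_eq_conj, Module.End.mul_eq_comp, conjHom_comp, conjHom_comp, conjHom_comp]
  congr 1
  refine LinearMap.ext fun f => ?_
  simp only [LinearMap.comp_apply, LinearMap.smul_apply, LinearMap.restrictScalars_apply, map_smul, XY, smul_smul]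
  ring_nf

/-- ★ FIELD `cop_eq`: `C⁻¹(V)` IS the two-sided inverse of `Q′(V)(η²G′(V))²Q′*(V)` whenever one exists — at every coded configuration: if that composite `= D` has a
two-sided inverse `X` then `CopC V = X` (`conj b` conjugates by the coordinate equivalence, so `(Q′G′²Q′*)(dec V)` is bijective, a unit of `End_ℂ`; `Ring.inverse` is then
its inverse, and two-sided inverses are unique). [cite: Balaban1985BackgroundPropagators, (3.21) p.394, Thm 3.2 p.398] -/
theorem copC_eq (c : CCfg (CfgY 𝔸 i) (AfldY 𝔸 i)) (D X : Module.End ℝ (BlkY i × ι → ℝ))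
    (hD : QcC i par b c ∘ₗ (GopC i par b c * GopC i par b c) ∘ₗ QcsC i par b c = D) (hDX : D * X = 1) (hXD : X * D = 1) : CopC i par b c = X := by
  set V := decY i c
  set η := (kGeo i).eta with hηdef
  have hη : η ≠ 0 := by
    rw [hηdef]; show |i.cf|⁻¹ ≠ 0
    exact inv_ne_zero (abs_ne_zero.2 i.hcf)
  have hη4 : (η ^ 4 : ℝ) ≠ 0 := pow_ne_zero 4 hη
  rw [XC_eq] at hD
  -- the `ℝ`-operator `T := η⁴·X(V)` on `BlkY → 𝔸` is bijective: `conj b T = D` is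
  set T : Module.End ℝ (BlkY i → 𝔸) := (η ^ 4) • (XY i par (GpY i par) V).restrictScalars ℝ with hT
  have hbijD : Function.Bijective D := (Module.End.isUnit_iff D).1 ⟨⟨D, X, hDX, hXD⟩, rfl⟩
  have hbijT : Function.Bijective T := by
    have hTe : (T : (BlkY i → 𝔸) → (BlkY i → 𝔸)) = (coordEquiv b).symm ∘ D ∘ (coordEquiv b) := by
      funext f
      have := congrArg (fun L : Module.End ℝ (BlkY i × ι → ℝ) => (coordEquiv b).symm (L (coordEquiv b f))) hD
      simpa [B9Eq352DivFormLetters.conj, LinearEquiv.conj_apply] using this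
    rw [hTe]
    exact (coordEquiv b).symm.bijective.comp (hbijD.comp (coordEquiv b).bijective)
  -- hence `X(V)` is bijective, a unit of `End_ℂ`
  have hbijX : Function.Bijective (XY i par (GpY i par) V) := by
    have hsc : ∀ f, XY i par (GpY i par) V f = (η ^ 4 : ℝ)⁻¹ • T f := fun f => by
      simp only [hT, LinearMap.smul_apply, LinearMap.restrictScalars_apply, smul_smul, inv_mul_cancel₀ hη4, one_smul]
    constructor
    · intro f g hfg
      have h' : (η ^ 4 : ℝ) • ((η ^ 4 : ℝ)⁻¹ • T f) = (η ^ 4 : ℝ) • ((η ^ 4 : ℝ)⁻¹ • T g) := by rw [← hsc, ← hsc, hfg]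
      rw [smul_smul, smul_smul, mul_inv_cancel₀ hη4, one_smul, one_smul] at h'
      exact hbijT.1 h'
    · intro g
      obtain ⟨f, hf⟩ := hbijT.2 ((η ^ 4 : ℝ) • g)
      exact ⟨f, by rw [hsc, hf, smul_smul, inv_mul_cancel₀ hη4, one_smul]⟩
  have hunit : IsUnit (XY i par (GpY i par) V) := (Module.End.isUnit_iff _).2 hbijX
  -- `CopC` inverts the composite, so it is `X`
  have h1 : conj b ((η ^ 4) • (XY i par (GpY i par) V).restrictScalars ℝ) * CopC i par b c = 1 := by
    rw [CopC, ← B9Eq352DivFormLetters.conj_mul]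
    have : ((η ^ 4) • (XY i par (GpY i par) V).restrictScalars ℝ) * ((η ^ 4)⁻¹ • (XinvY i par (GpY i par) V).restrictScalars ℝ) = 1 := by
      rw [smul_mul_smul_comm, mul_inv_cancel₀ hη4, one_smul, Module.End.mul_eq_comp, ← LinearMap.restrictScalars_comp,
        ← Module.End.mul_eq_comp, XinvY, Ring.mul_inverse_cancel _ hunit]
      rfl
    rw [this, conj_one]
  calc CopC i par b c = (X * D) * CopC i par b c := by rw [hXD, one_mul]
    _ = X * (conj b ((η ^ 4) • (XY i par (GpY i par) V).restrictScalars ℝ) * CopC i par b c) := by rw [mul_assoc, hD]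
    _ = X := by rw [h1, mul_one]

/-- ★ FIELD `reg_inv` at the letters: where `(Q′G′²Q′*)(dec V)` is a unit (Theorem 3.2 ∕ 3.11's regime; at the record `B9Thm311PosAtRecordV4.isUnit_XY_parSymY`, every
`G`-valued `U`, `G ≦ U(N)`), the composite of the letters and `CopC` are two-sided inverses. [cite: Balaban1985BackgroundPropagators, (3.21) p.394, Thm 3.2 p.398, Thm 3.11 p.416] -/
theorem XC_mul_CopC (c : CCfg (CfgY 𝔸 i) (AfldY 𝔸 i)) (hunit : IsUnit (XY i par (GpY i par) (decY i c))) :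
    (QcC i par b c ∘ₗ (GopC i par b c * GopC i par b c) ∘ₗ QcsC i par b c) * CopC i par b c = 1 ∧
      CopC i par b c * (QcC i par b c ∘ₗ (GopC i par b c * GopC i par b c) ∘ₗ QcsC i par b c) = 1 := by
  have hη : (kGeo i).eta ≠ 0 := by
    show |i.cf|⁻¹ ≠ 0
    exact inv_ne_zero (abs_ne_zero.2 i.hcf)
  have hη4 : ((kGeo i).eta ^ 4 : ℝ) ≠ 0 := pow_ne_zero 4 hη
  rw [XC_eq]
  constructor
  · rw [CopC, ← B9Eq352DivFormLetters.conj_mul, smul_mul_smul_comm, mul_inv_cancel₀ hη4, one_smul, Module.End.mul_eq_comp, ← LinearMap.restrictScalars_comp,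
      ← Module.End.mul_eq_comp, XinvY, Ring.mul_inverse_cancel _ hunit]
    exact conj_one b
  · rw [CopC, ← B9Eq352DivFormLetters.conj_mul, smul_mul_smul_comm, inv_mul_cancel₀ hη4, one_smul, Module.End.mul_eq_comp, ← LinearMap.restrictScalars_comp,
      ← Module.End.mul_eq_comp, XinvY, Ring.inverse_mul_cancel _ hunit]
    exact conj_one b

/-- FIELD `q_mul` at the letters, (3.57): `Q′(e^{iηa}U) = Q′(U) + F′₂` at a (base, multiplier) pair. [cite: Balaban1985BackgroundPropagators, (3.57) p.401] -/
theorem qcC_prod (U : CfgY 𝔸 i) (a : AfldY 𝔸 i) :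
    QcC i par b (.prod U a) = QcC i par b (.base U) + FcC i par b (.base U) (.mult a) := by
  rw [FcC, add_sub_cancel]

/-- FIELD `q_mul` at the letters, (3.57): `Q′*(e^{iηa}U) = Q′*(U) + F′₂*`. [cite: Balaban1985BackgroundPropagators, (3.57) p.401] -/
theorem qcsC_prod (U : CfgY 𝔸 i) (a : AfldY 𝔸 i) :
    QcsC i par b (.prod U a) = QcsC i par b (.base U) + FcsC i par b (.base U) (.mult a) := by
  rw [FcsC, add_sub_cancel]

end Laws

/-! ## §3 The (3.19) block-local two-space majorants of `QcC`, `QcsC` at a base (fields `hQc` ∕ `hQcs`) -/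

section Majorants

variable (i : KIdx d ℓ hd hL b₀ b₁) (par : SiteParY 𝔸 i) {ι : Type} [Fintype ι] (b : Module.Basis ι ℝ 𝔸) (ιB : BlkY i → IBondY i)
  [Fintype (geo9K i).Site] [DecidableEq (geo9K i).Site] {Rr : ℝ} {Hp : Prop}

/-- ★ FIELD `hQc` at the letters: at a base configuration with contractive transporters, `QcC (base U)` is BLOCK-LOCAL with the two-space majorant
`M₂Σ_j‖b_j‖·𝟙[a = a′]` from the site carrier (block map `(z, j) ↦ ι_B(s_z)`) to the block carrier (`(s, j) ↦ ι_B s`) — pv's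
`B9Thm39CinvSandwichQ.hasMajorantHom_conjHom_QpY` in the frame's shape. [cite: Balaban1985BackgroundPropagators, (3.19) p.393, (3.21) p.394; Balaban1984PropagatorsII, (2.51) p.232, (2.14) p.225] -/
theorem hasMajorantHom_QcC_base {U : CfgY 𝔸 i}
    (hparU : ∀ z w : SiteY i, ‖(par U z w : 𝔸)‖ ≤ 1 ∧ ‖(((par U z w)⁻¹ : 𝔸ˣ) : 𝔸)‖ ≤ 1)
    {M₂ : ℝ} (hM₂ : 0 ≤ M₂) (hrepr : ∀ (v : 𝔸) (j : ι), |b.repr v j| ≤ M₂ * ‖v‖) :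
    HasMajorantHom (g := toB6 (geo9K i) Rr Hp) (fun p : SiteY i × ι => blkC i ιB p.1) (fun q : BlkY i × ι => ιB q.1)
      (QcC i par b (.base U)) (fun a a' : IBondY i => (M₂ * ∑ j, ‖b j‖) * (if a = a' then (1 : ℝ) else 0)) :=
  hasMajorantHom_mono _ _ (B9Thm39CinvSandwichQ.hasMajorantHom_conjHom_QpY i b ιB par U hparU hM₂ hrepr) fun a a' => by
    split_ifs <;> simp_all

/-- ★ FIELD `hQcs` at the letters: at a base configuration with contractive transporters, `QcsC (base U)` is BLOCK-LOCAL with the two-space majorant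
`M₂Σ_j‖b_j‖·𝟙[a = a′]` from the block carrier to the site carrier — pv's `B9Thm39CinvSandwichQ.hasMajorantHom_conjHom_QpsY` in the frame's shape.
[cite: Balaban1985BackgroundPropagators, (3.24) p.394; Balaban1984PropagatorsII, (2.51) p.232, (2.16) p.225] -/
theorem hasMajorantHom_QcsC_base {U : CfgY 𝔸 i}
    (hparU : ∀ z w : SiteY i, ‖(par U z w : 𝔸)‖ ≤ 1 ∧ ‖(((par U z w)⁻¹ : 𝔸ˣ) : 𝔸)‖ ≤ 1)
    {M₂ : ℝ} (hM₂ : 0 ≤ M₂) (hrepr : ∀ (v : 𝔸) (j : ι), |b.repr v j| ≤ M₂ * ‖v‖) :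
    HasMajorantHom (g := toB6 (geo9K i) Rr Hp) (fun q : BlkY i × ι => ιB q.1) (fun p : SiteY i × ι => blkC i ιB p.1)
      (QcsC i par b (.base U)) (fun a a' : IBondY i => (M₂ * ∑ j, ‖b j‖) * (if a = a' then (1 : ℝ) else 0)) :=
  hasMajorantHom_mono _ _ (B9Thm39CinvSandwichQ.hasMajorantHom_conjHom_QpsY i b ιB par U hparU hM₂ hrepr) fun a a' => by
    split_ifs <;> simp_all

end Majorants

/-! ## §4 Kernel-reading tools for the block sector: the entries of `CopC`, the `𝔸`-valued delta through the basis, the sup over the unit ball -/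

section KernelTools

variable (i : KIdx d ℓ hd hL b₀ b₁) (par : SiteParY 𝔸 i) {ι : Type} [Fintype ι] (b : Module.Basis ι ℝ 𝔸)

omit [CompleteSpace 𝔸] in
/-- the inverse coordinates of a unit vector of the block carrier: the `𝔸`-valued delta `δ_{s′} ⊗ b_{j′}`. [cite: Balaban1984PropagatorsII, (2.51) p.232, bookkeeping] -/
theorem coordEquiv_symm_single [DecidableEq ι] {X : Type} [DecidableEq X] (q' : X × ι) :
    (coordEquiv b (S := X)).symm (Pi.single q' (1 : ℝ)) = deltaY q'.1 (b q'.2) := by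
  funext s
  rw [coordEquiv_symm_apply, deltaY]
  by_cases hs : s = q'.1
  · rw [if_pos hs, Finset.sum_eq_single q'.2]
    · rw [hs, show ((q'.1, q'.2) : X × ι) = q' from rfl, Pi.single_eq_same, one_smul]
    · intro j _ hj
      rw [Pi.single_apply, if_neg (fun h => hj (by rw [← h] : q'.2 = j).symm |>.elim), zero_smul]
    · intro h; exact absurd (Finset.mem_univ _) h
  · refine (Finset.sum_eq_zero fun j _ => ?_).trans (if_neg hs).symm
    rw [Pi.single_apply, if_neg (fun h => hs (by rw [← h])), zero_smul]

/-- ★ **THE ENTRIES OF `CopC`**: `CopC V (δ_{(s′,j′)})(s, j) = η⁻⁴·b.repr((Q′G′²Q′*)⁻¹(dec V)(δ_{s′} ⊗ b_{j′})(s))_j`. [cite: Balaban1985BackgroundPropagators, (3.48) p.398; Balaban1984PropagatorsII, (2.51) p.232] -/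
theorem entry_CopC [DecidableEq ι] (c : CCfg (CfgY 𝔸 i) (AfldY 𝔸 i)) (q q' : BlkY i × ι) :
    entry (CopC i par b c) q q' =
      ((kGeo i).eta ^ 4)⁻¹ * b.repr (XinvY i par (GpY i par) (decY i c) (deltaY q'.1 (b q'.2)) q.1) q.2 := by
  rw [entry, CopC, B9Eq352DivFormLetters.conj_apply, coordEquiv_symm_single, LinearMap.smul_apply, LinearMap.restrictScalars_apply, Pi.smul_apply,
    map_smul, Finsupp.smul_apply, smul_eq_mul]

omit [CompleteSpace 𝔸] in
/-- the `𝔸`-valued delta expanded in the basis: `δ_w ⊗ E = Σ_j (b.repr E)_j·(δ_w ⊗ b_j)`. [cite: Balaban1984PropagatorsII, (2.51) p.232, bookkeeping] -/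
theorem deltaY_eq_sum_repr {X : Type} [DecidableEq X] (w : X) (E : 𝔸) : deltaY w E = ∑ j, (b.repr E j) • deltaY w (b j) := by
  funext z
  rw [Finset.sum_apply]
  simp only [deltaY, Pi.smul_apply]
  split_ifs
  · conv_lhs => rw [← b.sum_repr E]
  · simp

omit [CompleteSpace 𝔸] in
/-- ★ **A LETTER ON AN `𝔸`-VALUED DELTA IS BOUNDED OVER THE UNIT BALL** (finite real basis): `‖T(δ_w ⊗ E)(x)‖ ≦ M₂·Σ_j‖T(δ_w ⊗ b_j)(x)‖·‖E‖`.
[cite: Balaban1985BackgroundPropagators, (3.48) p.398 (the sup over `|E| ≦ 1`); Balaban1984PropagatorsII, (2.51) p.232] -/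
theorem norm_apply_deltaY_le {X Y : Type} [DecidableEq Y] (T : (Y → 𝔸) →ₗ[ℂ] (X → 𝔸)) {M₂ : ℝ}
    (hrepr : ∀ (v : 𝔸) (j : ι), |b.repr v j| ≤ M₂ * ‖v‖) (w : Y) (x : X) (E : 𝔸) :
    ‖T (deltaY w E) x‖ ≤ (M₂ * ∑ j, ‖T (deltaY w (b j)) x‖) * ‖E‖ := by
  rw [deltaY_eq_sum_repr b w E, map_sum, Finset.sum_apply]
  calc ‖∑ j, T ((b.repr E j) • deltaY w (b j)) x‖ ≤ ∑ j, ‖T ((b.repr E j) • deltaY w (b j)) x‖ := norm_sum_le _ _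
    _ ≤ ∑ j, M₂ * ‖E‖ * ‖T (deltaY w (b j)) x‖ := Finset.sum_le_sum fun j _ => by
        rw [LinearMap.map_smul_of_tower, Pi.smul_apply, norm_smul, Real.norm_eq_abs]
        exact mul_le_mul_of_nonneg_right (hrepr E j) (norm_nonneg _)
    _ = (M₂ * ∑ j, ‖T (deltaY w (b j)) x‖) * ‖E‖ := by rw [Finset.mul_sum, Finset.sum_mul]; refine Finset.sum_congr rfl fun j _ => ?_; ring

/-- hence the sup over the unit ball exists. [cite: Balaban1985BackgroundPropagators, (3.48) p.398, bookkeeping] -/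
theorem bddAbove_norm_apply_deltaY {X Y : Type} [DecidableEq Y] (T : (Y → 𝔸) →ₗ[ℂ] (X → 𝔸)) {M₂ : ℝ} (hM₂ : 0 ≤ M₂)
    (hrepr : ∀ (v : 𝔸) (j : ι), |b.repr v j| ≤ M₂ * ‖v‖) (w : Y) (x : X) :
    BddAbove (Set.range fun E : BallY 𝔸 => ‖T (deltaY w (E : 𝔸)) x‖) := by
  refine ⟨(M₂ * ∑ j, ‖T (deltaY w (b j)) x‖) * 1, ?_⟩
  rintro _ ⟨E, rfl⟩
  have hM : 0 ≤ M₂ * ∑ j, ‖T (deltaY w (b j)) x‖ := mul_nonneg hM₂ (Finset.sum_nonneg fun j _ => norm_nonneg _)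
  exact (norm_apply_deltaY_le b T hrepr w x (E : 𝔸)).trans (mul_le_mul_of_nonneg_left (mem_closedBall_zero_iff.1 E.2) hM)

/-- ★ **A BASIS VECTOR IS BELOW THE SUP OVER THE UNIT BALL**: `‖T(δ_w ⊗ b_j)(x)‖ ≦ ‖b_j‖·sup_{|E| ≦ 1} ‖T(δ_w ⊗ E)(x)‖`.
[cite: Balaban1985BackgroundPropagators, (3.48) p.398, bookkeeping] -/
theorem norm_apply_deltaY_basis_le {X Y : Type} [DecidableEq Y] (T : (Y → 𝔸) →ₗ[ℂ] (X → 𝔸)) {M₂ : ℝ} (hM₂ : 0 ≤ M₂)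
    (hrepr : ∀ (v : 𝔸) (j : ι), |b.repr v j| ≤ M₂ * ‖v‖) (w : Y) (x : X) (j : ι) :
    ‖T (deltaY w (b j)) x‖ ≤ ‖b j‖ * ⨆ E : BallY 𝔸, ‖T (deltaY w (E : 𝔸)) x‖ := by
  have hbdd := bddAbove_norm_apply_deltaY b T hM₂ hrepr w x
  have hsup0 : 0 ≤ ⨆ E : BallY 𝔸, ‖T (deltaY w (E : 𝔸)) x‖ := Real.iSup_nonneg fun E => norm_nonneg _
  by_cases h0 : ‖b j‖ = 0
  · have hb : b j = 0 := norm_eq_zero.1 h0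
    have hd : deltaY w (b j) = 0 := by funext z; simp [deltaY, hb]
    rw [hd, map_zero, Pi.zero_apply, norm_zero, h0, zero_mul]
  · have hpos : 0 < ‖b j‖ := lt_of_le_of_ne (norm_nonneg _) (Ne.symm h0)
    set E₀ : 𝔸 := ‖b j‖⁻¹ • b j with hE₀
    have hE₀n : ‖E₀‖ ≤ 1 := by
      rw [hE₀, norm_smul, norm_inv, norm_norm, inv_mul_cancel₀ h0]
    have hbj : b j = ‖b j‖ • E₀ := by rw [hE₀, smul_smul, mul_inv_cancel₀ h0, one_smul]
    have hds : deltaY w (‖b j‖ • E₀) = ‖b j‖ • deltaY w E₀ := by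
      funext z; by_cases hz : z = w <;> simp [deltaY, hz]
    have hT : T (deltaY w (b j)) x = ‖b j‖ • T (deltaY w E₀) x := by
      conv_lhs => rw [hbj, hds, LinearMap.map_smul_of_tower, Pi.smul_apply]
    rw [hT, norm_smul, norm_norm]
    exact mul_le_mul_of_nonneg_left (le_ciSup hbdd ⟨E₀, mem_closedBall_zero_iff.2 hE₀n⟩) hpos.le

end KernelTools

/-! ## §5 The block-compatible injective section of the block carrier into the site carrier (the binders `rep`, `hrep`, `hinj` of r06's blk clauses) -/

section Section

open Literature.MathematicalPhysics.QuantumFieldTheory.Balaban1983to89.B6Geom246MultiLevelBox (blkOf_corner)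

variable (i : KIdx d ℓ hd hL b₀ b₁) (ι : Type) (ιB : BlkY i → IBondY i)

/-- **THE SECTION `rep : BlkY × ι → SiteY × ι`**: a block is represented by its corner site (`Node00.blkCornerY`), the 𝔤-coordinate is kept — the
binder `rep` of r06's block-carrier clauses (`B9Thm34GUniformBlk.thm34_G_clause_uniform_blk`, FILE 17 `B6RandomWalkSection`) for node00-def-Y's carriers.
[cite: Balaban1984PropagatorsII, (2.3)–(2.4) p.224 (the corner of a block), (2.51) p.232] -/
def repY : BlkY i × ι → SiteY i × ι := fun q => (blkCornerY i q.1, q.2)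

/-- the section is BLOCK-COMPATIBLE: the block of the corner of `s` is `s` (binder `hrep`). [cite: Balaban1984PropagatorsII, (2.3)–(2.4) p.224, bookkeeping] -/
theorem blkC_repY (q : BlkY i × ι) : blkC i ιB (repY i ι q).1 = ιB q.1 := by
  show ιB (blkY i (blkCornerY i q.1)) = ιB q.1
  rw [blkY_apply]
  exact congrArg ιB (blkOf_corner i.D.toDomains q.1)

/-- the section is INJECTIVE (binder `hinj`). [cite: Balaban1984PropagatorsII, (2.3)–(2.4) p.224, bookkeeping] -/
theorem repY_injective : Function.Injective (repY i ι) := by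
  intro q q' h
  have h1 : blkCornerY i q.1 = blkCornerY i q'.1 := congrArg Prod.fst h
  have h2 : (repY i ι q).2 = (repY i ι q').2 := congrArg Prod.snd h
  have e := congrArg (fun z : SiteY i => blkOf i.D.toDomains z) h1
  have hs : q.1 = q'.1 :=
    calc q.1 = blkOf i.D.toDomains (blkCornerY i q.1) := (blkOf_corner i.D.toDomains q.1).symm
      _ = blkOf i.D.toDomains (blkCornerY i q'.1) := e
      _ = q'.1 := blkOf_corner i.D.toDomains q'.1
  exact Prod.ext hs h2

end Section

end Literature.MathematicalPhysics.QuantumFieldTheory.Balaban1983to89.B9SectBKerLettersY
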